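import Literature.Analysis.FluidPDE.TaoAveragedRealParts
import Literature.Analysis.FluidPDE.TaoAveragedComplexAverageLinear
import Literature.Analysis.FluidPDE.TaoAveragedSobolevProofs
import HarnessLib

/-!
# Tao's averaged Navier–Stokes blow-up: discharge of `complexAverage_isAveraged` (§3.1)

T. Tao, *Finite time blowup for an averaged three-dimensional Navier–Stokes equation*,
J. Amer. Math. Soc. **29** (2016), 601–674 = arXiv:1402.0290v3 (held as `paper:arxiv-1402.0290`;
all numbers are those of that text), §3.1 "First step: complexification", p. 15:

> "The multipliers `m_{j,ω}(D)` for `j = 1, 2, 3` appearing in the expansion (3.4) are not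
> required to be real, but we can decompose them as `m_{j,ω,1}(D) + i m_{j,ω,2}(D)` where
> `m_{j,ω,1}(D), m_{j,ω,2}(D)` are real ... Thus we can decompose the right-hand side of (3.4) as
> the sum of `2³ = 8` pieces, each of which is of the same form as the original right-hand side
> up to a power of `i`, and with all the `m_{j,ω}(D)` appearing in each piece being a real Fourier
> multiplier. As the left-hand side of (3.4) is real (as are the inner products on the right-hand
> side), we may eliminate all the terms on the right-hand side involving odd powers of `i` by
> taking real parts. The power of `i` in each of the four remaining terms is now just a sign `±1`
> and can be absorbed into the `m_{1,ω}(D)` factor; by concatenating together four copies of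
> `(Ω, μ)` we may now obtain an expansion of the form (3.4) in which all the `m_{j,ω}(D)` are
> real. Finally, by multiplying `m_{1,ω}(D)` by a normalising constant we may take `(Ω, μ)` to be a
> probability space rather than a finite measure space."

This file proves the named fact
`Literature.Analysis.FluidPDE.Tao2016.complexAverage_isAveraged` (`TaoAveragedComplexAverage.lean`)
— *a complex average (Def. 3.4) of the Euler bilinear operator `B` that is real on real fields
`u, v, w ∈ H¹⁰_df` is an averaged Euler bilinear operator (1.12)–(1.13)* — exactly along these
lines (`complexAverage_isAveraged_holds`), on top of

* `TaoAveragedRealParts.lean` (this prover): the decomposition `m = m₁ + i m₂` of complex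
  order-`0` symbols into real ones with `‖m₁‖_k, ‖m₂‖_k ≤ ‖m‖_k`, `m(D) = m₁(D) + i m₂(D)`, and
  the realness of `⟨B(x,y), z⟩` for Fourier-Hermitian (e.g. real) `x, y, z`;
* the support files of the sibling fact `complexAverage_linear_right` (accepted):
  `TaoAveragedEulerFormBound.lean` (absolute convergence of (1.3), `integrable_Λ_fourierFn`),
  `TaoAveragedSlotBounds.lean` (`H^s` bounds of the slots `m(D) Rot Dil`),
  `TaoAveragedSlotMeasurable.lean` (measurability in `ω` of the integrand of (3.4)),
  `TaoAveragedComplexAverageLinear.lean` (absolute convergence of (3.4) for `C' = B`, Tao p. 7: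
  `ComplexAveragingDatum.integrable_eulerForm_slot`) and `TaoAveragedSlotFourier.lean`.

## Contents

* `eulerForm_add_smul₁/₂/₃`, `eulerForm_smul₁` — trilinearity of `⟨B(x,y), z⟩` on `H¹⁰`
  (additivity needs the absolute convergence of (1.3); homogeneity does not);
* `ComplexAveragingDatum.parts`, `….partSlot`, `….piece` — the data with symbols replaced by their
  real/imaginary parts and the eight pieces `G_{abc}` of the expansion; `….slot_expansion` — the
  expansion of the integrand of (3.4) into the eight pieces grouped by the parity of the power of
  `i`; `….piece_im` — each piece is real on real fields; `….average_eq_integral_even_pieces` —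
  **taking real parts**: a complex average that is real equals `∫ (G₁₁₁ - G₁₂₂ - G₂₁₂ - G₂₂₁)`;
* `ComplexAveragingDatum.realParts` — **the averaging datum** on `Ω × ({tt,ff} × {tt,ff})` (four
  copies of `(Ω, μ)`), probability measure `(4μ(Ω))⁻¹ Σ_k (ι_k)_*μ`, real symbols
  `(±4μ(Ω) · m_{1,ω,a}, m_{2,ω,q}, m_{3,ω,r})` on the copy `k = (q, r)`, `a = (q ↔ r)`;
  `….realParts_form` — its form is `∫G₁₁₁ - ∫G₁₂₂ - ∫G₂₁₂ - ∫G₂₂₁`;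
* `AveragingDatum.zero` — the degenerate case `μ = 0` (then the complex average vanishes on
  `H¹⁰_df`, and so does the form of the datum with zero symbols);
* `complexAverage_isAveraged_holds`.

## References

* T. Tao, J. Amer. Math. Soc. 29 (2016), 601–674, arXiv:1402.0290v3, §1.1 pp. 6–7 ((1.3),
  (1.10)–(1.13)), §3.1 p. 15 (Def. 3.4, (3.4)–(3.5)), Thm. 3.2. Key `Tao2016AveragedNS`.
-/

noncomputable section

open MeasureTheory Set Filter FourierTransform
open scoped ENNReal NNReal SchwartzMap ComplexConjugate

namespace Literature.Analysis.FluidPDE.Tao2016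

/-- Local notation for physical / frequency space `ℝ³`. -/
local notation "ℝ³" => EuclideanSpace ℝ (Fin 3)
/-- Local notation for the complexified range `ℂ³`. -/
local notation "ℂ³" => EuclideanSpace ℂ (Fin 3)

open FunctionSpaces (eFourierSobolevNorm)


/-! ### Finiteness of Sobolev norms under sums and scalars -/

/-- Finiteness of the `H^s` norm is stable under sums. [folklore] -/
theorem eFourierSobolevNorm_add_lt_top {s : ℝ} {u v : L2C} (hu : eFourierSobolevNorm s u < ∞)
    (hv : eFourierSobolevNorm s v < ∞) : eFourierSobolevNorm s (u + v) < ∞ := by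
  rw [eFourierSobolevNorm_lt_top_iff, sobolevWeightIntegral_congr_ae (fourierFn_add u v)]
  refine lt_of_le_of_lt
    (sobolevWeightIntegral_add_le s (aestronglyMeasurable_fourierFn u) (fourierFn v)) ?_
  exact ENNReal.mul_lt_top (by simp) (ENNReal.add_lt_top.2
    ⟨(eFourierSobolevNorm_lt_top_iff _ _).1 hu, (eFourierSobolevNorm_lt_top_iff _ _).1 hv⟩)

/-- Finiteness of the `H^s` norm is stable under complex scalars. [folklore] -/
theorem eFourierSobolevNorm_smul_lt_top {s : ℝ} {u : L2C} (hu : eFourierSobolevNorm s u < ∞)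
    (c : ℂ) : eFourierSobolevNorm s (c • u) < ∞ := by
  rw [eFourierSobolevNorm_lt_top_iff, sobolevWeightIntegral_congr_ae (fourierFn_smul c u),
    sobolevWeightIntegral_smul]
  exact ENNReal.mul_lt_top (ENNReal.pow_lt_top enorm_lt_top)
    ((eFourierSobolevNorm_lt_top_iff _ _).1 hu)

/-! ### Realness of rotated fields -/

/-- **Rotations preserve realness** (the matrix of `R` is real). [folklore] -/
theorem isReal_rot {u : L2C} (hu : IsReal u) (R : ℝ³ ≃ₗᵢ[ℝ] ℝ³) : IsReal (rot R u) := by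
  unfold IsReal
  filter_upwards [coeFn_rot R u, R.symm.measurePreserving.quasiMeasurePreserving.ae hu]
    with x h1 h2
  intro i
  rw [h1, complexifyCLM_apply, Complex.im_sum]
  refine Finset.sum_eq_zero fun j _ => ?_
  rw [Complex.mul_im, Complex.ofReal_re, Complex.ofReal_im, h2 j, mul_zero, zero_mul, add_zero]

/-! ### Homogeneity and (conditional) additivity of the Euler form -/

/-- `Λ` is linear in its first vector argument. [cite: Tao2016AveragedNS, (1.4)] -/
theorem Λ_add_smul₁ (ξ₁ ξ₂ : ℝ³) (c : ℂ) (X X' X₂ X₃ : ℂ³) :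
    Λ ξ₁ ξ₂ (X + c • X') X₂ X₃ = Λ ξ₁ ξ₂ X X₂ X₃ + c * Λ ξ₁ ξ₂ X' X₂ X₃ := by
  simp only [Λ, cdot, PiLp.add_apply, PiLp.smul_apply, smul_eq_mul, Fin.sum_univ_three]
  ring

/-- `Λ` is linear in its second vector argument. [cite: Tao2016AveragedNS, (1.4)] -/
theorem Λ_add_smul₂ (ξ₁ ξ₂ : ℝ³) (c : ℂ) (X₁ X X' X₃ : ℂ³) :
    Λ ξ₁ ξ₂ X₁ (X + c • X') X₃ = Λ ξ₁ ξ₂ X₁ X X₃ + c * Λ ξ₁ ξ₂ X₁ X' X₃ := by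
  simp only [Λ, cdot, PiLp.add_apply, PiLp.smul_apply, smul_eq_mul, Fin.sum_univ_three]
  ring

/-- `Λ` is linear in its third vector argument. [cite: Tao2016AveragedNS, (1.4)] -/
theorem Λ_add_smul₃ (ξ₁ ξ₂ : ℝ³) (c : ℂ) (X₁ X₂ X X' : ℂ³) :
    Λ ξ₁ ξ₂ X₁ X₂ (X + c • X') = Λ ξ₁ ξ₂ X₁ X₂ X + c * Λ ξ₁ ξ₂ X₁ X₂ X' := by
  simp only [Λ, cdot, PiLp.add_apply, PiLp.smul_apply, smul_eq_mul, Fin.sum_univ_three]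
  ring

/-- The integrand of (1.3). [cite: Tao2016AveragedNS, (1.3)] -/
def eulerIntegrand (x y z : L2C) (p : ℝ³ × ℝ³) : ℂ :=
  Λ p.1 p.2 (fourierFn x p.1) (fourierFn y p.2) (fourierFn z (-p.1 - p.2))

/-- `⟨B(x,y), z⟩ = -πi ∫ eulerIntegrand`. [cite: Tao2016AveragedNS, (1.3)] -/
theorem eulerForm_eq_integral (x y z : L2C) :
    eulerForm x y z = -(Real.pi * Complex.I) * ∫ p, eulerIntegrand x y z p := rfl

/-- Transfer of a.e. identities to the three frequency variables of (1.3). [folklore] -/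
theorem ae_prod_of_ae₁ {P : ℝ³ → Prop} (h : ∀ᵐ ξ ∂(volume : Measure ℝ³), P ξ) :
    ∀ᵐ p : ℝ³ × ℝ³ ∂volume, P p.1 := by
  rw [Measure.volume_eq_prod]
  exact (Measure.quasiMeasurePreserving_fst (μ := volume) (ν := volume)).ae h

/-- Transfer of a.e. identities to the second frequency variable. [folklore] -/
theorem ae_prod_of_ae₂ {P : ℝ³ → Prop} (h : ∀ᵐ ξ ∂(volume : Measure ℝ³), P ξ) :
    ∀ᵐ p : ℝ³ × ℝ³ ∂volume, P p.2 := by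
  rw [Measure.volume_eq_prod]
  exact (Measure.quasiMeasurePreserving_snd (μ := volume) (ν := volume)).ae h

/-- Transfer of a.e. identities to the third frequency variable `ξ₃ = -ξ₁ - ξ₂`. [folklore] -/
theorem ae_prod_of_ae₃ {P : ℝ³ → Prop} (h : ∀ᵐ ξ ∂(volume : Measure ℝ³), P ξ) :
    ∀ᵐ p : ℝ³ × ℝ³ ∂volume, P (-p.1 - p.2) := by
  rw [Measure.volume_eq_prod]
  exact ((Measure.quasiMeasurePreserving_snd (μ := volume) (ν := volume)).comp
    (measurePreserving_shear₂₃ (volume : Measure ℝ³)).quasiMeasurePreserving).ae h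

/-- The integrand of (1.3) is linear in `x` (a.e.). [cite: Tao2016AveragedNS, (1.3)] -/
theorem eulerIntegrand_add_smul₁ (c : ℂ) (x x' y z : L2C) :
    eulerIntegrand (x + c • x') y z =ᵐ[volume]
      fun p => eulerIntegrand x y z p + c * eulerIntegrand x' y z p := by
  have h : fourierFn (x + c • x') =ᵐ[volume] fun ξ => fourierFn x ξ + c • fourierFn x' ξ := by
    filter_upwards [fourierFn_add x (c • x'), fourierFn_smul c x'] with ξ h1 h2
    rw [h1, h2]
  filter_upwards [ae_prod_of_ae₁ h] with p hp
  simp only [eulerIntegrand, hp, Λ_add_smul₁]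

/-- The integrand of (1.3) is linear in `y` (a.e.). [cite: Tao2016AveragedNS, (1.3)] -/
theorem eulerIntegrand_add_smul₂ (c : ℂ) (x y y' z : L2C) :
    eulerIntegrand x (y + c • y') z =ᵐ[volume]
      fun p => eulerIntegrand x y z p + c * eulerIntegrand x y' z p := by
  have h : fourierFn (y + c • y') =ᵐ[volume] fun ξ => fourierFn y ξ + c • fourierFn y' ξ := by
    filter_upwards [fourierFn_add y (c • y'), fourierFn_smul c y'] with ξ h1 h2
    rw [h1, h2]
  filter_upwards [ae_prod_of_ae₂ h] with p hp
  simp only [eulerIntegrand, hp, Λ_add_smul₂]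

/-- The integrand of (1.3) is linear in `z` (a.e.). [cite: Tao2016AveragedNS, (1.3)] -/
theorem eulerIntegrand_add_smul₃ (c : ℂ) (x y z z' : L2C) :
    eulerIntegrand x y (z + c • z') =ᵐ[volume]
      fun p => eulerIntegrand x y z p + c * eulerIntegrand x y z' p := by
  have h : fourierFn (z + c • z') =ᵐ[volume] fun ξ => fourierFn z ξ + c • fourierFn z' ξ := by
    filter_upwards [fourierFn_add z (c • z'), fourierFn_smul c z'] with ξ h1 h2
    rw [h1, h2]
  filter_upwards [ae_prod_of_ae₃ h] with p hp
  simp only [eulerIntegrand, hp, Λ_add_smul₃]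

/-- `Λ` is homogeneous in its first vector argument. [cite: Tao2016AveragedNS, (1.4)] -/
theorem Λ_smul₁ (ξ₁ ξ₂ : ℝ³) (c : ℂ) (X₁ X₂ X₃ : ℂ³) :
    Λ ξ₁ ξ₂ (c • X₁) X₂ X₃ = c * Λ ξ₁ ξ₂ X₁ X₂ X₃ := by
  simp only [Λ, cdot, PiLp.smul_apply, smul_eq_mul, Fin.sum_univ_three]
  ring

/-- **Homogeneity of the Euler form** in `x`: `⟨B(cx,y), z⟩ = c ⟨B(x,y), z⟩` (no convergence
needed). [cite: Tao2016AveragedNS, (1.3)] -/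
theorem eulerForm_smul₁ (c : ℂ) (x y z : L2C) : eulerForm (c • x) y z = c * eulerForm x y z := by
  have h : eulerIntegrand (c • x) y z =ᵐ[volume] fun p => c * eulerIntegrand x y z p := by
    filter_upwards [ae_prod_of_ae₁ (fourierFn_smul c x)] with p hp
    simp only [eulerIntegrand, hp, Λ_smul₁]
  rw [eulerForm_eq_integral, eulerForm_eq_integral, integral_congr_ae h, integral_const_mul]
  ring

/-! ### Additivity of the Euler form on `H¹⁰` (from the absolute convergence of (1.3), accepted `integrable_Λ_fourierFn`) -/

/-- **The Euler form is linear in `x` on `H¹⁰`** (by the absolute convergence of (1.3)). [cite: Tao2016AveragedNS, (1.3)] -/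
theorem eulerForm_add_smul₁ (c : ℂ) {x x' y : L2C} (z : L2C)
    (hx : eFourierSobolevNorm 10 x < ∞) (hx' : eFourierSobolevNorm 10 x' < ∞)
    (hy : eFourierSobolevNorm 10 y < ∞) :
    eulerForm (x + c • x') y z = eulerForm x y z + c * eulerForm x' y z := by
  have h1 : Integrable (eulerIntegrand x y z) volume := integrable_Λ_fourierFn z hx hy
  have h2 : Integrable (eulerIntegrand x' y z) volume := integrable_Λ_fourierFn z hx' hy
  rw [eulerForm_eq_integral, eulerForm_eq_integral, eulerForm_eq_integral,
    integral_congr_ae (eulerIntegrand_add_smul₁ c x x' y z),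
    integral_add h1 (h2.const_mul c), integral_const_mul]
  ring

/-- **The Euler form is linear in `y` on `H¹⁰`** (by the absolute convergence of (1.3)). [cite: Tao2016AveragedNS, (1.3)] -/
theorem eulerForm_add_smul₂ (c : ℂ) {x y y' : L2C} (z : L2C)
    (hx : eFourierSobolevNorm 10 x < ∞) (hy : eFourierSobolevNorm 10 y < ∞)
    (hy' : eFourierSobolevNorm 10 y' < ∞) :
    eulerForm x (y + c • y') z = eulerForm x y z + c * eulerForm x y' z := by
  have h1 : Integrable (eulerIntegrand x y z) volume := integrable_Λ_fourierFn z hx hy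
  have h2 : Integrable (eulerIntegrand x y' z) volume := integrable_Λ_fourierFn z hx hy'
  rw [eulerForm_eq_integral, eulerForm_eq_integral, eulerForm_eq_integral,
    integral_congr_ae (eulerIntegrand_add_smul₂ c x y y' z),
    integral_add h1 (h2.const_mul c), integral_const_mul]
  ring

/-- **The Euler form is linear in `z` on `H¹⁰`** (by the absolute convergence of (1.3)). [cite: Tao2016AveragedNS, (1.3)] -/
theorem eulerForm_add_smul₃ (c : ℂ) {x y : L2C} (z z' : L2C)
    (hx : eFourierSobolevNorm 10 x < ∞) (hy : eFourierSobolevNorm 10 y < ∞) :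
    eulerForm x y (z + c • z') = eulerForm x y z + c * eulerForm x y z' := by
  have h1 : Integrable (eulerIntegrand x y z) volume := integrable_Λ_fourierFn z hx hy
  have h2 : Integrable (eulerIntegrand x y z') volume := integrable_Λ_fourierFn z' hx hy
  rw [eulerForm_eq_integral, eulerForm_eq_integral, eulerForm_eq_integral,
    integral_congr_ae (eulerIntegrand_add_smul₃ c x y z z'),
    integral_add h1 (h2.const_mul c), integral_const_mul]
  ring

/-! ### Parts of the symbols of a complex averaging datum -/

/-- Selector of the real (`true`) or imaginary (`false`) part of a symbol. [cite: Tao2016AveragedNS, §3.1 p. 15] -/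
def partSym (b : Bool) (m : ℝ³ → ℂ) : ℝ³ → ℂ := bif b then reSymbol m else imSymbol m

/-- A part of a complex order-`0` symbol is a real order-`0` symbol. [cite: Tao2016AveragedNS, §1.1 p. 6] -/
theorem IsComplexSymbol.isRealSymbol_partSym {m : ℝ³ → ℂ} (hm : IsComplexSymbol m) (b : Bool) :
    IsRealSymbol (partSym b m) := by
  cases b
  exacts [hm.isRealSymbol_imSymbol, hm.isRealSymbol_reSymbol]

/-- Seminorms of a part: `‖partSym b m‖_k ≤ ‖m‖_k`. [cite: Tao2016AveragedNS, §3.1 p. 15] -/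
theorem symbolSeminorm_partSym_le {m : ℝ³ → ℂ} (hm : IsComplexSymbol m) (b : Bool) (k : ℕ) :
    symbolSeminorm k (partSym b m) ≤ symbolSeminorm k m := by
  cases b
  exacts [symbolSeminorm_imSymbol_le hm k, symbolSeminorm_reSymbol_le hm k]

/-- Measurability of a part in a parameter. [folklore] -/
theorem measurable_partSym {Ω : Type*} [MeasurableSpace Ω] (b : Bool) {m : Ω → ℝ³ → ℂ}
    (hm : ∀ ξ, ξ ≠ 0 → Measurable fun θ => m θ ξ) {ξ : ℝ³} (hξ : ξ ≠ 0) :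
    Measurable fun θ => partSym b (m θ) ξ := by
  cases b
  exacts [measurable_symbolPart _ _ hm hξ, measurable_symbolPart _ _ hm hξ]

namespace ComplexAveragingDatum

variable (𝒟 : ComplexAveragingDatum)

/-- **The datum of parts**: the complex averaging datum obtained from `𝒟` by replacing the symbol
of slot `i` by its real (`b i = true`) or imaginary (`b i = false`) part — each of the `2³ = 8`
pieces of the expansion of (3.4) (Tao 2016, §3.1 p. 15) is the average of `B` over such a datum
(up to a power of `i`). Same measure space, rotations and dilations; the integrability
conditions (3.5) follow from `‖m_{j,ω,1}‖_k, ‖m_{j,ω,2}‖_k ≤ ‖m_{j,ω}‖_k`. [cite: Tao2016AveragedNS, §3.1 p. 15] -/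
def parts (b : Fin 3 → Bool) : ComplexAveragingDatum where
  Ω := 𝒟.Ω
  μ := 𝒟.μ
  m i θ := partSym (b i) (𝒟.m i θ)
  R := 𝒟.R
  lam := 𝒟.lam
  isComplexSymbol i θ := ((𝒟.isComplexSymbol i θ).isRealSymbol_partSym (b i)).isComplexSymbol
  det_R := 𝒟.det_R
  lam_pos := 𝒟.lam_pos
  lam_bdd := 𝒟.lam_bdd
  moment k₁ k₂ k₃ := by
    refine lt_of_le_of_lt (lintegral_mono fun θ => ?_) (𝒟.moment k₁ k₂ k₃)
    exact mul_le_mul' (mul_le_mul' (symbolSeminorm_partSym_le (𝒟.isComplexSymbol 0 θ) _ _)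
      (symbolSeminorm_partSym_le (𝒟.isComplexSymbol 1 θ) _ _))
      (symbolSeminorm_partSym_le (𝒟.isComplexSymbol 2 θ) _ _)
  measurable_m i ξ hξ := measurable_partSym (b i) (𝒟.measurable_m i) hξ
  measurable_R := 𝒟.measurable_R
  measurable_lam := 𝒟.measurable_lam

/-- **The part slots** `m_{i,ω,1}(D) Rot Dil` (`true`) and `m_{i,ω,2}(D) Rot Dil` (`false`) of a
complex averaging datum. [cite: Tao2016AveragedNS, §3.1 p. 15] -/
def partSlot (i : Fin 3) (c : Bool) (θ : 𝒟.Ω) (x : L2C) : L2C :=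
  fourierMultiplier (((𝒟.isComplexSymbol i θ).isRealSymbol_partSym c).memLp_top.toLp
    (partSym c (𝒟.m i θ))) (rot (𝒟.R i θ) (dil (𝒟.lam i θ) x))

/-- The slots of a datum of parts are the part slots. [cite: Tao2016AveragedNS, §3.1 p. 15] -/
theorem parts_slot (b : Fin 3 → Bool) (i : Fin 3) (θ : 𝒟.Ω) (x : L2C) :
    (𝒟.parts b).slot i θ x = 𝒟.partSlot i (b i) θ x := rfl

/-- **Decomposition of a slot**: `m_{i,ω}(D) Rot Dil x = m_{i,ω,1}(D) Rot Dil x + i m_{i,ω,2}(D) Rot Dil x`. [cite: Tao2016AveragedNS, §3.1 p. 15] -/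
theorem slot_eq_partSlot (i : Fin 3) (θ : 𝒟.Ω) (x : L2C) :
    𝒟.slot i θ x = 𝒟.partSlot i true θ x + Complex.I • 𝒟.partSlot i false θ x :=
  (𝒟.isComplexSymbol i θ).fourierMultiplier_eq_re_add_im _

/-- Part slots map `H¹⁰` into `H¹⁰` (accepted `eFourierSobolevNorm_slot_lt_top` for the data of parts). [cite: Tao2016AveragedNS, §1.1 p. 6] -/
theorem eFourierSobolevNorm_partSlot_lt_top (i : Fin 3) (c : Bool) (θ : 𝒟.Ω) {x : L2C}
    (hx : eFourierSobolevNorm 10 x < ∞) : eFourierSobolevNorm 10 (𝒟.partSlot i c θ x) < ∞ :=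
  (𝒟.parts fun _ => c).eFourierSobolevNorm_slot_lt_top i θ hx

/-- **Part slots of real fields are Fourier-Hermitian** (real symbols, `Rot`, `Dil` preserve
realness). [cite: Tao2016AveragedNS, §1.1 p. 6] -/
theorem isFourierHermitian_partSlot (i : Fin 3) (c : Bool) (θ : 𝒟.Ω) {x : L2C} (hx : IsReal x) :
    IsFourierHermitian (𝒟.partSlot i c θ x) :=
  IsFourierHermitian.fourierMultiplier
    ((𝒟.isComplexSymbol i θ).isRealSymbol_partSym c).conj_toLp_ae
    (isReal_rot (isReal_dil hx _) _).isFourierHermitian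

/-- **Each piece of the expansion is real on real fields** ("as are the inner products on the
right-hand side", Tao 2016, p. 15). [cite: Tao2016AveragedNS, §3.1 p. 15] -/
theorem eulerForm_partSlot_im (a b c : Bool) (θ : 𝒟.Ω) {u v w : L2C} (hu : IsReal u)
    (hv : IsReal v) (hw : IsReal w) :
    (eulerForm (𝒟.partSlot 0 a θ u) (𝒟.partSlot 1 b θ v) (𝒟.partSlot 2 c θ w)).im = 0 :=
  eulerForm_im_of_isFourierHermitian (𝒟.isFourierHermitian_partSlot 0 a θ hu)
    (𝒟.isFourierHermitian_partSlot 1 b θ hv) (𝒟.isFourierHermitian_partSlot 2 c θ hw)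


/-! ### The averaged Euler datum of §3.1: four copies of `(Ω, μ)`, signs, normalisation -/

/-- The sign of a surviving piece of the expansion: `+` for `(m₁₁, m₂₁, m₃₁)` (`k = (tt, tt)`),
`-` for the three pieces with two imaginary parts (Tao 2016, §3.1: "The power of `i` in each of
the four remaining terms is now just a sign `±1`"). [cite: Tao2016AveragedNS, §3.1 p. 15] -/
def pieceSign (k : Bool × Bool) : ℝ := bif (k.1 && k.2) then 1 else -1

/-- The normalising constant `4 μ(Ω)` (four copies of `(Ω, μ)`, Tao 2016, §3.1). [cite: Tao2016AveragedNS, §3.1 p. 15] -/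
def normConst : ℝ := (4 * 𝒟.μ univ).toReal

/-- **The averaging datum produced by §3.1** from a complex averaging datum `𝒟` with `μ(Ω) ≠ 0`:
sample space `Ω × ({tt, ff} × {tt, ff})` ("concatenating together four copies of `(Ω, μ)`"),
probability measure `(4μ(Ω))⁻¹ Σ_k (ι_k)_* μ` ("multiplying `m_{1,ω}(D)` by a normalising
constant we may take `(Ω, μ)` to be a probability space"), and on the copy `k = (q, r)` the real
symbols `(± 4μ(Ω) · m_{1,ω,a}, m_{2,ω,q}, m_{3,ω,r})` with `a = (q ↔ r)` and the sign of the
piece ("can be absorbed into the `m_{1,ω}(D)` factor"); rotations and dilations are those of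
`𝒟`. [cite: Tao2016AveragedNS, §3.1 p. 15] -/
def realParts (h0 : 𝒟.μ univ ≠ 0) : AveragingDatum where
  Ω := 𝒟.Ω × (Bool × Bool)
  μ := (4 * 𝒟.μ univ)⁻¹ • ∑ k : Bool × Bool, Measure.map (fun θ : 𝒟.Ω => (θ, k)) 𝒟.μ
  isProb := by
    constructor
    rw [Measure.smul_apply, Measure.finsetSum_apply, smul_eq_mul]
    have h : ∀ k : Bool × Bool, Measure.map (fun θ : 𝒟.Ω => (θ, k)) 𝒟.μ univ = 𝒟.μ univ :=
      fun k => by rw [Measure.map_apply measurable_prodMk_right MeasurableSet.univ, Set.preimage_univ]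
    simp only [h, Finset.sum_const, Finset.card_univ, Fintype.card_prod, Fintype.card_bool,
      nsmul_eq_mul]
    norm_num
    exact ENNReal.inv_mul_cancel (mul_ne_zero (by norm_num) h0)
      (ENNReal.mul_ne_top (by norm_num) (measure_ne_top _ _))
  m i ω := ![scaleSymbol (pieceSign ω.2 * 𝒟.normConst) (partSym (ω.2.1 == ω.2.2) (𝒟.m 0 ω.1)),
    partSym ω.2.1 (𝒟.m 1 ω.1), partSym ω.2.2 (𝒟.m 2 ω.1)] i
  R i ω := 𝒟.R i ω.1
  lam i ω := 𝒟.lam i ω.1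
  isRealSymbol i ω := by
    fin_cases i
    · exact ((𝒟.isComplexSymbol 0 ω.1).isRealSymbol_partSym _).scaleSymbol _
    · exact (𝒟.isComplexSymbol 1 ω.1).isRealSymbol_partSym _
    · exact (𝒟.isComplexSymbol 2 ω.1).isRealSymbol_partSym _
  det_R i ω := 𝒟.det_R i ω.1
  lam_pos i ω := 𝒟.lam_pos i ω.1
  lam_bdd := 𝒟.lam_bdd.imp fun C hC i ω => hC i ω.1
  moment k₁ k₂ k₃ := by
    rw [lintegral_smul_measure, lintegral_finsetSum_measure, smul_eq_mul]
    refine ENNReal.mul_lt_top (ENNReal.inv_lt_top.mpr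
      (pos_iff_ne_zero.mpr (mul_ne_zero (by norm_num) h0))) (ENNReal.sum_lt_top.mpr fun k _ => ?_)
    rw [(measurableEmbedding_prod_mk_right k).lintegral_map]
    set r : ℝ := pieceSign k * 𝒟.normConst with hr
    have hpt : ∀ θ : 𝒟.Ω,
        symbolSeminorm k₁ (scaleSymbol r (partSym (k.1 == k.2) (𝒟.m 0 θ))) *
          symbolSeminorm k₂ (partSym k.1 (𝒟.m 1 θ)) * symbolSeminorm k₃ (partSym k.2 (𝒟.m 2 θ)) ≤
        ‖(r : ℂ)‖ₑ * (symbolSeminorm k₁ (𝒟.m 0 θ) * symbolSeminorm k₂ (𝒟.m 1 θ) *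
          symbolSeminorm k₃ (𝒟.m 2 θ)) := fun θ => by
      have h0' : symbolSeminorm k₁ (scaleSymbol r (partSym (k.1 == k.2) (𝒟.m 0 θ))) ≤
          ‖(r : ℂ)‖ₑ * symbolSeminorm k₁ (𝒟.m 0 θ) :=
        (symbolSeminorm_scaleSymbol_le r
          ((𝒟.isComplexSymbol 0 θ).isRealSymbol_partSym _).1 k₁).trans
          (mul_le_mul' le_rfl (symbolSeminorm_partSym_le (𝒟.isComplexSymbol 0 θ) _ _))
      calc _ ≤ ‖(r : ℂ)‖ₑ * symbolSeminorm k₁ (𝒟.m 0 θ) * symbolSeminorm k₂ (𝒟.m 1 θ) *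
            symbolSeminorm k₃ (𝒟.m 2 θ) :=
            mul_le_mul' (mul_le_mul' h0' (symbolSeminorm_partSym_le (𝒟.isComplexSymbol 1 θ) _ _))
              (symbolSeminorm_partSym_le (𝒟.isComplexSymbol 2 θ) _ _)
        _ = _ := by ring
    calc ∫⁻ θ, symbolSeminorm k₁ (scaleSymbol r (partSym (k.1 == k.2) (𝒟.m 0 θ))) *
          symbolSeminorm k₂ (partSym k.1 (𝒟.m 1 θ)) * symbolSeminorm k₃ (partSym k.2 (𝒟.m 2 θ)) ∂𝒟.μ
        ≤ ∫⁻ θ, ‖(r : ℂ)‖ₑ * (symbolSeminorm k₁ (𝒟.m 0 θ) * symbolSeminorm k₂ (𝒟.m 1 θ) *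
          symbolSeminorm k₃ (𝒟.m 2 θ)) ∂𝒟.μ := lintegral_mono hpt
      _ = ‖(r : ℂ)‖ₑ * ∫⁻ θ, symbolSeminorm k₁ (𝒟.m 0 θ) * symbolSeminorm k₂ (𝒟.m 1 θ) *
          symbolSeminorm k₃ (𝒟.m 2 θ) ∂𝒟.μ := lintegral_const_mul' _ _ enorm_ne_top
      _ < ∞ := ENNReal.mul_lt_top enorm_lt_top (𝒟.moment k₁ k₂ k₃)
  measurable_m i ξ hξ := by
    refine measurable_from_prod_countable_left fun k => ?_
    fin_cases i
    · show Measurable fun θ => ((pieceSign k * 𝒟.normConst : ℝ) : ℂ) *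
        partSym (k.1 == k.2) (𝒟.m 0 θ) ξ
      exact (measurable_partSym _ (𝒟.measurable_m 0) hξ).const_mul _
    · show Measurable fun θ => partSym k.1 (𝒟.m 1 θ) ξ
      exact measurable_partSym _ (𝒟.measurable_m 1) hξ
    · show Measurable fun θ => partSym k.2 (𝒟.m 2 θ) ξ
      exact measurable_partSym _ (𝒟.measurable_m 2) hξ
  measurable_R i x := (𝒟.measurable_R i x).comp measurable_fst
  measurable_lam i := (𝒟.measurable_lam i).comp measurable_fst

/-- The normalising constant is positive when `μ(Ω) ≠ 0`. [folklore] -/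
theorem normConst_pos (h0 : 𝒟.μ univ ≠ 0) : 0 < 𝒟.normConst :=
  ENNReal.toReal_pos (mul_ne_zero (by norm_num) h0)
    (ENNReal.mul_ne_top (by norm_num) (measure_ne_top _ _))

/-- Slot `0` of the real-parts datum on the copy `k`: the signed, normalised part slot. [cite: Tao2016AveragedNS, §3.1 p. 15] -/
theorem realParts_slot₀ (h0 : 𝒟.μ univ ≠ 0) (θ : 𝒟.Ω) (k : Bool × Bool) (x : L2C) :
    (𝒟.realParts h0).slot 0 (θ, k) x =
      ((pieceSign k * 𝒟.normConst : ℝ) : ℂ) • 𝒟.partSlot 0 (k.1 == k.2) θ x := by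
  unfold AveragingDatum.slot AveragingDatum.symbolLp partSlot
  rw [← fourierMultiplier_symbol_smul]
  rfl

/-- Slot `1` of the real-parts datum on the copy `k = (q, r)`: the part slot `q`. [cite: Tao2016AveragedNS, §3.1 p. 15] -/
theorem realParts_slot₁ (h0 : 𝒟.μ univ ≠ 0) (θ : 𝒟.Ω) (k : Bool × Bool) (x : L2C) :
    (𝒟.realParts h0).slot 1 (θ, k) x = 𝒟.partSlot 1 k.1 θ x := rfl

/-- Slot `2` of the real-parts datum on the copy `k = (q, r)`: the part slot `r`. [cite: Tao2016AveragedNS, §3.1 p. 15] -/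
theorem realParts_slot₂ (h0 : 𝒟.μ univ ≠ 0) (θ : 𝒟.Ω) (k : Bool × Bool) (x : L2C) :
    (𝒟.realParts h0).slot 2 (θ, k) x = 𝒟.partSlot 2 k.2 θ x := rfl

/-- The pieces `G_{abc}(ω) = ⟨B(m_{1,ω,a}(D)ũ, m_{2,ω,b}(D)ṽ), m_{3,ω,c}(D)w̃⟩` of the expansion of
(3.4). [cite: Tao2016AveragedNS, §3.1 p. 15] -/
def piece (a b c : Bool) (u v w : L2C) (θ : 𝒟.Ω) : ℂ :=
  eulerForm (𝒟.partSlot 0 a θ u) (𝒟.partSlot 1 b θ v) (𝒟.partSlot 2 c θ w)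

/-- Each piece is the integrand of (3.4) for a datum of parts, hence integrable for `H¹⁰`
arguments (accepted `integrable_eulerForm_slot`, the absolute convergence of (3.4), Tao p. 7). [cite: Tao2016AveragedNS, §3.1 p. 15] -/
theorem integrable_piece (a b c : Bool) {u v : L2C} (w : L2C)
    (hu : eFourierSobolevNorm 10 u < ∞) (hv : eFourierSobolevNorm 10 v < ∞) :
    Integrable (𝒟.piece a b c u v w) 𝒟.μ :=
  (𝒟.parts ![a, b, c]).integrable_eulerForm_slot w hu hv

/-- Each piece is real on real fields. [cite: Tao2016AveragedNS, §3.1 p. 15] -/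
theorem piece_im (a b c : Bool) {u v w : L2C} (hu : IsReal u) (hv : IsReal v) (hw : IsReal w)
    (θ : 𝒟.Ω) : (𝒟.piece a b c u v w θ).im = 0 :=
  𝒟.eulerForm_partSlot_im a b c θ hu hv hw

/-- **The form of the real-parts datum is the signed sum of the four surviving pieces**:
`⟨B̃_𝒜(u,v), w⟩ = ∫G_{111} - ∫G_{122} - ∫G_{212} - ∫G_{221}` (the normalising constant cancels the
normalisation of the measure). [cite: Tao2016AveragedNS, §3.1 p. 15] -/
theorem realParts_form (h0 : 𝒟.μ univ ≠ 0) {u v : L2C} (w : L2C)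
    (hu : eFourierSobolevNorm 10 u < ∞) (hv : eFourierSobolevNorm 10 v < ∞) :
    (𝒟.realParts h0).form u v w =
      ∑ k : Bool × Bool, (pieceSign k : ℂ) * ∫ θ, 𝒟.piece (k.1 == k.2) k.1 k.2 u v w θ ∂𝒟.μ := by
  have hM : (4 * 𝒟.μ univ).toReal ≠ 0 := (𝒟.normConst_pos h0).ne'
  have hE : ∀ ω : 𝒟.Ω × (Bool × Bool),
      eulerForm ((𝒟.realParts h0).slot 0 ω u) ((𝒟.realParts h0).slot 1 ω v)
        ((𝒟.realParts h0).slot 2 ω w) =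
      ((pieceSign ω.2 * 𝒟.normConst : ℝ) : ℂ) * 𝒟.piece (ω.2.1 == ω.2.2) ω.2.1 ω.2.2 u v w ω.1 := by
    rintro ⟨θ, k⟩
    rw [realParts_slot₀, realParts_slot₁, realParts_slot₂, eulerForm_smul₁]
    rfl
  unfold AveragingDatum.form
  simp_rw [hE]
  change ∫ ω, _ ∂((4 * 𝒟.μ univ)⁻¹ • ∑ k : Bool × Bool, Measure.map (fun θ : 𝒟.Ω => (θ, k)) 𝒟.μ) = _
  rw [integral_smul_measure, integral_finsetSum_measure, Finset.smul_sum]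
  · refine Finset.sum_congr rfl fun k _ => ?_
    rw [(measurableEmbedding_prod_mk_right k).integral_map]
    dsimp only
    rw [integral_const_mul, ENNReal.toReal_inv, Complex.real_smul, ← mul_assoc, ← Complex.ofReal_mul]
    congr 1
    unfold normConst
    rw [Complex.ofReal_inj, mul_comm (pieceSign k), ← mul_assoc, inv_mul_cancel₀ hM, one_mul]
  · intro k _
    rw [(measurableEmbedding_prod_mk_right k).integrable_map_iff]
    show Integrable (fun θ => ((pieceSign k * 𝒟.normConst : ℝ) : ℂ) *
      𝒟.piece (k.1 == k.2) k.1 k.2 u v w θ) 𝒟.μ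
    exact (𝒟.integrable_piece (k.1 == k.2) k.1 k.2 w hu hv).const_mul _

/-- **The expansion of (3.4) into `2³ = 8` pieces** (Tao 2016, §3.1 p. 15), grouped by parity of
the power of `i`: for `u, v, w` of finite `H¹⁰` norm,
`⟨B(m₁(D)ũ, m₂(D)ṽ), m₃(D)w̃⟩ = (G₁₁₁ - G₁₂₂ - G₂₁₂ - G₂₂₁) + i (G₂₁₁ + G₁₂₁ + G₁₁₂ - G₂₂₂)`
(trilinearity of `B` on `H¹⁰`, by the absolute convergence of (1.3)). [cite: Tao2016AveragedNS, §3.1 p. 15] -/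
theorem slot_expansion (θ : 𝒟.Ω) {u v : L2C} (w : L2C)
    (hu : eFourierSobolevNorm 10 u < ∞) (hv : eFourierSobolevNorm 10 v < ∞) :
    eulerForm (𝒟.slot 0 θ u) (𝒟.slot 1 θ v) (𝒟.slot 2 θ w) =
      (𝒟.piece true true true u v w θ - 𝒟.piece true false false u v w θ -
          𝒟.piece false true false u v w θ - 𝒟.piece false false true u v w θ) +
        Complex.I * (𝒟.piece false true true u v w θ + 𝒟.piece true false true u v w θ +
          𝒟.piece true true false u v w θ - 𝒟.piece false false false u v w θ) := by
  -- finiteness of the part slots and of the full slot 1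
  have ha := fun c => 𝒟.eFourierSobolevNorm_partSlot_lt_top 0 c θ hu
  have hb := fun c => 𝒟.eFourierSobolevNorm_partSlot_lt_top 1 c θ hv
  have hS₂ : eFourierSobolevNorm 10 (𝒟.partSlot 1 true θ v + Complex.I • 𝒟.partSlot 1 false θ v) < ∞ :=
    eFourierSobolevNorm_add_lt_top (hb true) (eFourierSobolevNorm_smul_lt_top (hb false) _)
  rw [𝒟.slot_eq_partSlot 0, 𝒟.slot_eq_partSlot 1, 𝒟.slot_eq_partSlot 2,
    eulerForm_add_smul₁ _ _ (ha true) (ha false) hS₂,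
    eulerForm_add_smul₂ _ _ (ha true) (hb true) (hb false),
    eulerForm_add_smul₂ _ _ (ha false) (hb true) (hb false),
    eulerForm_add_smul₃ _ _ _ (ha true) (hb true), eulerForm_add_smul₃ _ _ _ (ha true) (hb false),
    eulerForm_add_smul₃ _ _ _ (ha false) (hb true), eulerForm_add_smul₃ _ _ _ (ha false) (hb false)]
  unfold piece
  linear_combination (eulerForm (𝒟.partSlot 0 true θ u) (𝒟.partSlot 1 false θ v) (𝒟.partSlot 2 false θ w) +
    eulerForm (𝒟.partSlot 0 false θ u) (𝒟.partSlot 1 true θ v) (𝒟.partSlot 2 false θ w) +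
    eulerForm (𝒟.partSlot 0 false θ u) (𝒟.partSlot 1 false θ v) (𝒟.partSlot 2 true θ w) +
    Complex.I * eulerForm (𝒟.partSlot 0 false θ u) (𝒟.partSlot 1 false θ v) (𝒟.partSlot 2 false θ w)) *
    Complex.I_mul_I

/-- The integral of a pointwise-real complex function is real. [folklore] -/
theorem integral_im_eq_zero_of_forall_im_eq_zero {Ω : Type*} [MeasurableSpace Ω] {μ : Measure Ω}
    {f : Ω → ℂ} (hf : ∀ θ, (f θ).im = 0) : (∫ θ, f θ ∂μ).im = 0 := by
  have h : f = fun θ => (((f θ).re : ℝ) : ℂ) := funext fun θ => eq_ofReal_re_of_im_eq_zero (hf θ)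
  rw [h, integral_complex_ofReal, Complex.ofReal_im]

/-- **Taking real parts** (Tao 2016, §3.1 p. 15: "we may eliminate all the terms on the
right-hand side involving odd powers of `i` by taking real parts"): if the complex average is
real on real `u, v, w ∈ H¹⁰`, it is the integral of the four even pieces. [cite: Tao2016AveragedNS, §3.1 p. 15] -/
theorem average_eq_integral_even_pieces {u v w : L2C} (hu : MemH10df u) (hv : MemH10df v)
    (hw : MemH10df w) (hreal : (𝒟.average eulerForm u v w).im = 0) :
    𝒟.average eulerForm u v w =
      ∫ θ, (𝒟.piece true true true u v w θ - 𝒟.piece true false false u v w θ -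
        𝒟.piece false true false u v w θ - 𝒟.piece false false true u v w θ) ∂𝒟.μ := by
  set P : 𝒟.Ω → ℂ := fun θ => 𝒟.piece true true true u v w θ - 𝒟.piece true false false u v w θ -
    𝒟.piece false true false u v w θ - 𝒟.piece false false true u v w θ with hP
  set Q : 𝒟.Ω → ℂ := fun θ => 𝒟.piece false true true u v w θ + 𝒟.piece true false true u v w θ +
    𝒟.piece true true false u v w θ - 𝒟.piece false false false u v w θ with hQ
  have hG := fun a b c => 𝒟.integrable_piece a b c w hu.1 hv.1
  have hPi : Integrable P 𝒟.μ := (((hG _ _ _).sub (hG _ _ _)).sub (hG _ _ _)).sub (hG _ _ _)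
  have hQi : Integrable Q 𝒟.μ := (((hG _ _ _).add (hG _ _ _)).add (hG _ _ _)).sub (hG _ _ _)
  have hexp : 𝒟.average eulerForm u v w = (∫ θ, P θ ∂𝒟.μ) + Complex.I * ∫ θ, Q θ ∂𝒟.μ := by
    unfold average
    rw [← integral_const_mul, ← integral_add hPi (hQi.const_mul _)]
    refine integral_congr_ae (Eventually.of_forall fun θ => ?_)
    exact 𝒟.slot_expansion θ w hu.1 hv.1
  have him := fun a b c θ => 𝒟.piece_im a b c hu.2.1 hv.2.1 hw.2.1 θ
  have hPreal : (∫ θ, P θ ∂𝒟.μ).im = 0 :=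
    integral_im_eq_zero_of_forall_im_eq_zero fun θ => by simp [hP, him]
  have hQreal : (∫ θ, Q θ ∂𝒟.μ).im = 0 :=
    integral_im_eq_zero_of_forall_im_eq_zero fun θ => by simp [hQ, him]
  have hQre : (∫ θ, Q θ ∂𝒟.μ).re = 0 := by
    have h := hreal
    rw [hexp, Complex.add_im, Complex.mul_im, Complex.I_re, Complex.I_im, hPreal, hQreal] at h
    linarith
  have hQ0 : ∫ θ, Q θ ∂𝒟.μ = 0 := Complex.ext (by simpa using hQre) (by simpa using hQreal)
  rw [hexp, hQ0, mul_zero, add_zero]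

end ComplexAveragingDatum

/-! ### The zero datum (the degenerate case `μ = 0`) -/

namespace AveragingDatum

/-- The averaging datum with vanishing symbols (probability space a point), whose form is
identically `0`; used for the degenerate case `μ(Ω) = 0` of a complex average. [folklore] -/
def zero : AveragingDatum where
  Ω := Unit
  μ := Measure.dirac ()
  m := fun _ _ _ => ((0 : ℝ) : ℂ)
  R := fun _ _ => LinearIsometryEquiv.refl ℝ _
  lam := fun _ _ => 1
  isRealSymbol := fun _ _ => isRealSymbol_const 0
  det_R := fun _ _ => LinearMap.det_id
  lam_pos := fun _ _ => one_pos
  lam_bdd := ⟨1, fun _ _ => by norm_num⟩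
  moment := fun k₁ k₂ k₃ => by
    rw [lintegral_dirac]
    have hfin : ∀ k, symbolSeminorm k (fun _ : ℝ³ => ((0 : ℝ) : ℂ)) < ∞ :=
      fun k => (isRealSymbol_const 0).2.1 k
    exact ENNReal.mul_lt_top (ENNReal.mul_lt_top (hfin k₁) (hfin k₂)) (hfin k₃)
  measurable_m := fun _ _ _ => measurable_const
  measurable_R := fun _ _ => measurable_const
  measurable_lam := fun _ => measurable_const

/-- The slots of the zero datum vanish. [folklore] -/
theorem zero_slot (i : Fin 3) (θ : zero.Ω) (x : L2C) : zero.slot i θ x = 0 := by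
  unfold slot symbolLp
  have h : ((zero.isRealSymbol i θ).memLp_top).toLp (zero.m i θ) = 0 := by
    rw [← MemLp.toLp_zero (MemLp.zero' (p := ∞) (μ := (volume : Measure ℝ³)))]
    exact MemLp.toLp_congr _ _ (Eventually.of_forall fun ξ => by simp [zero])
  rw [h]
  unfold fourierMultiplier
  rw [Lp.zero_smul, FourierTransform.fourierInv_zero]

/-- The form of the zero datum vanishes. [folklore] -/
theorem zero_form (u v w : L2C) : zero.form u v w = 0 := by
  unfold form
  simp [zero_slot, eulerForm_zero_left]

end AveragingDatum

/-! ### Theorem: §3.1 from the absolute convergence of (1.3) and (3.4) -/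

/-- **Tao 2016, §3.1 ("first step: complexification"), discharged**: a complex average (Def. 3.4)
of the Euler bilinear operator `B` that is real on real fields `u, v, w ∈ H¹⁰_df` is an averaged
Euler bilinear operator (1.12)–(1.13) — the named fact `complexAverage_isAveraged`. Proof as printed
(p. 15): decompose `m_{j,ω} = m_{j,ω,1} + i m_{j,ω,2}` (`TaoAveragedRealParts`), expand (3.4) into
`2³ = 8` pieces (`slot_expansion`, by trilinearity of `B` on `H¹⁰`, i.e. the absolute convergence
of (1.3)), take real parts using the realness of both sides (`average_eq_integral_even_pieces`,
`eulerForm_im_of_isFourierHermitian`, and the absolute convergence of (3.4), accepted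
`integrable_eulerForm_slot`), absorb the signs into `m_{1,ω}`, concatenate four copies of
`(Ω, μ)` and normalise (`ComplexAveragingDatum.realParts`, `realParts_form`); the degenerate case
`μ = 0` is the zero datum. [cite: Tao2016AveragedNS, §3.1 p. 15] -/
theorem complexAverage_isAveraged_holds : complexAverage_isAveraged := by
  intro T hT hreal
  obtain ⟨𝒟, h𝒟⟩ := hT
  by_cases h0 : 𝒟.μ univ = 0
  · refine ⟨AveragingDatum.zero, fun u v w hu hv hw => ?_⟩
    rw [AveragingDatum.zero_form, h𝒟 u v w hu.memH10dfC hv.memH10dfC hw.memH10dfC,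
      ComplexAveragingDatum.average, Measure.measure_univ_eq_zero.mp h0, integral_zero_measure]
  · refine ⟨𝒟.realParts h0, fun u v w hu hv hw => ?_⟩
    have hreal' : (𝒟.average eulerForm u v w).im = 0 := by
      rw [← h𝒟 u v w hu.memH10dfC hv.memH10dfC hw.memH10dfC]
      exact hreal u v w hu hv hw
    rw [h𝒟 u v w hu.memH10dfC hv.memH10dfC hw.memH10dfC,
      𝒟.average_eq_integral_even_pieces hu hv hw hreal', 𝒟.realParts_form h0 w hu.1 hv.1]
    have hG := fun a b c => 𝒟.integrable_piece a b c w hu.1 hv.1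
    have i1 : Integrable (fun θ => 𝒟.piece true true true u v w θ -
        𝒟.piece true false false u v w θ) 𝒟.μ := (hG _ _ _).sub (hG _ _ _)
    have i2 : Integrable (fun θ => 𝒟.piece true true true u v w θ -
        𝒟.piece true false false u v w θ - 𝒟.piece false true false u v w θ) 𝒟.μ :=
      i1.sub (hG _ _ _)
    rw [integral_sub i2 (hG _ _ _), integral_sub i1 (hG _ _ _), integral_sub (hG _ _ _) (hG _ _ _),
      Fintype.sum_prod_type]
    simp only [Fintype.sum_bool]
    have s1 : ComplexAveragingDatum.pieceSign (true, true) = 1 := rfl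
    have s2 : ComplexAveragingDatum.pieceSign (true, false) = -1 := rfl
    have s3 : ComplexAveragingDatum.pieceSign (false, true) = -1 := rfl
    have s4 : ComplexAveragingDatum.pieceSign (false, false) = -1 := rfl
    have b1 : (true == true) = true := rfl
    have b2 : (true == false) = false := rfl
    have b3 : (false == true) = false := rfl
    have b4 : (false == false) = true := rfl
    simp only [s1, s2, s3, s4, b1, b2, b3, b4]
    push_cast
    ring




end Literature.Analysis.FluidPDE.Tao2016
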